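import Mathlib
import HarnessLib
import Summits.HubbardSuperconductivity.HubbardSuperconductivity.Theorems.KLProgrammeKLRegimeCountertermJacksonRemainderAlongCurve

/-!
# Route `KLProgramme`, crux K3 — gen-8 ENGINE-FLOW child (stmt-HubbardSuperconductivity-20437 `KLRegimeEngineV17F2`), stub (C)
# `stub_twoLeg_curvature`: the (C1) JACKSON-REMAINDER DOOR v2, part 2 — the MEAN-FREE PRODUCT STRUCTURE of the displaced difference
# and the CUTOFF-DEFECT MOMENTS

Seat hubbard-kl-k3c3-p1 (g6; row «δμ-flow with klAngularMean constant piece»).  The tube extension of an angular profile is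
`E_μ f = mean f + χ·A` — a CONSTANT piece (the angular mean, immune to the Jackson mean), a smooth CUTOFF `χ` (`= 1` on the flat tube that
carries the curve) and a smooth ANGULAR factor `A` (`= (f − mean f)∘angle`, no cutoff inside).  Along a displaced curve `γ − v` the displaced
difference of part 1 therefore splits EXACTLY as

  `Δ(ϑ) := G(γϑ − v) − G(γϑ) = (χ(γϑ − v) − 1)·A(γϑ − v) + (A(γϑ − v) − A(γϑ))`      (`G = m + χ·A`, `χ∘γ = 1`):

a CUTOFF-DEFECT × displaced angular factor (supported on displacements that leave the flat tube) plus a pure TRANSPORT term (no cutoff).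
By Leibniz, `|∂ᵏΔ(θ)| ≤ Σᵢ C(k,i)·|∂ⁱ[χ∘(γ−v) − 1](θ)|·|∂^{k−i}[A∘(γ−v)](θ)| + |∂ᵏ[A∘(γ−v)](θ) − ∂ᵏ[A∘γ](θ)|` (§1), and integrating against
the Jackson weight with part 1's majorant form, the remainder's jets along the curve are bounded by the f-INDEPENDENT **cutoff-defect
moments** `N_i(θ) ≥ ∫ J̃J̃(w)·|∂ⁱ[χ∘(γ − v_w) − 1](θ)| dμ(w)` times sup-sizes of the displaced angular factor, plus the transport's first-moment
gain (§2: **`abs_iteratedDeriv_jhigh1_comp_curve_le_defectMoments`**).  The `N_i` are the objects a certificate (n ≤ 2) or a sup-type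
bound (n ≥ 3, k3c3-p3's `cutoff_displaced_jets` × far mass) supplies; evidence: `C1-CUTOFF-DEFECT-MOMENTS.md` on 20437.

Pure real analysis; no definitions; nothing about the model; nothing here asserts superconductivity.
-/

noncomputable section

namespace Summit.HubbardSuperconductivity.HubbardSuperconductivity.Theorems.KLRegimeSplit

set_option linter.dupNamespace false -- summit = problem name (single-conjunct summit), D-0017

open Real MeasureTheory Filter Metric Function
open scoped Topology ContDiff
open Literature.Analysis.Fourier.TrigApprox Literature.MathematicalPhysics.QuantumLattice

/-! ## §1 The pointwise structured bound for one displacement -/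

section Pointwise

variable {G χ A : EuclideanSpace ℝ (Fin 2) → ℝ} {m : ℝ} {γ : ℝ → EuclideanSpace ℝ (Fin 2)} {v : EuclideanSpace ℝ (Fin 2)} {θ : ℝ}

/-- `|∂ⁱ f(θ)| = ‖Dⁱ f(θ)‖` for a real function of one variable. -/
theorem abs_iteratedDeriv_eq_norm_iteratedFDeriv (f : ℝ → ℝ) (i : ℕ) (θ : ℝ) :
    |iteratedDeriv i f θ| = ‖iteratedFDeriv ℝ i f θ‖ := by
  rw [← Real.norm_eq_abs, norm_iteratedFDeriv_eq_norm_iteratedDeriv]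

/-- **The mean-free product structure, exactly**: if `G = m + χ·A` and `χ ≡ 1` along `γ`, then for every `k`
`∂ᵏ[G∘(γ−v)](θ) − ∂ᵏ[G∘γ](θ) = ∂ᵏ[((χ∘(γ−v)) − 1)·(A∘(γ−v))](θ) + (∂ᵏ[A∘(γ−v)](θ) − ∂ᵏ[A∘γ](θ))` (`k ≤ 4`, the displaced factors `C⁴` in `ϑ`). -/
theorem iteratedDeriv_displacedDiff_eq_structured (hGdec : ∀ q, G q = m + χ q * A q) (hflat : ∀ ϑ : ℝ, χ (γ ϑ) = 1)
    (hcv : ContDiff ℝ 4 (fun ϑ : ℝ => χ (γ ϑ - v))) (hAv : ContDiff ℝ 4 (fun ϑ : ℝ => A (γ ϑ - v))) {k : ℕ} (hk : k ≤ 4) (θ : ℝ) :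
    iteratedDeriv k (fun ϑ : ℝ => G (γ ϑ - v)) θ - iteratedDeriv k (fun ϑ : ℝ => G (γ ϑ)) θ =
      iteratedDeriv k (fun ϑ : ℝ => (χ (γ ϑ - v) - 1) * A (γ ϑ - v)) θ +
        (iteratedDeriv k (fun ϑ : ℝ => A (γ ϑ - v)) θ - iteratedDeriv k (fun ϑ : ℝ => A (γ ϑ)) θ) := by
  have hk' : (k : WithTop ℕ∞) ≤ 4 := by exact_mod_cast hk
  have hP : ContDiff ℝ 4 (fun ϑ : ℝ => (χ (γ ϑ - v) - 1) * A (γ ϑ - v)) := (hcv.sub contDiff_const).mul hAv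
  have ev : (fun ϑ : ℝ => G (γ ϑ - v)) = fun ϑ : ℝ => m + ((fun ϑ : ℝ => (χ (γ ϑ - v) - 1) * A (γ ϑ - v)) + fun ϑ : ℝ => A (γ ϑ - v)) ϑ := by
    funext ϑ; simp only [Pi.add_apply, hGdec]; ring
  have e0 : (fun ϑ : ℝ => G (γ ϑ)) = fun ϑ : ℝ => m + A (γ ϑ) := by
    funext ϑ; rw [hGdec, hflat ϑ, one_mul]
  rw [ev, e0]
  rcases Nat.eq_zero_or_pos k with rfl | hk0
  · simp only [iteratedDeriv_zero, Pi.add_apply]; ring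
  · rw [iteratedDeriv_const_add hk0, iteratedDeriv_const_add hk0, iteratedDeriv_add (hP.contDiffAt.of_le hk') (hAv.contDiffAt.of_le hk')]
    ring

/-- **THE POINTWISE STRUCTURED BOUND**: under `G = m + χ·A`, `χ∘γ ≡ 1`, with cutoff-defect jets `|∂ⁱ[χ∘(γ−v) − 1](θ)| ≤ c i`, displaced
angular jets `|∂ʲ[A∘(γ−v)](θ)| ≤ a j` (`i, j ≤ k`) and a transport bound `|∂ᵏ[A∘(γ−v)](θ) − ∂ᵏ[A∘γ](θ)| ≤ t`:
`|∂ᵏ[G∘(γ−v)](θ) − ∂ᵏ[G∘γ](θ)| ≤ Σ_{i ≤ k} C(k,i)·c i·a (k−i) + t` (`k ≤ 4`). -/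
theorem abs_iteratedDeriv_displacedDiff_le_structured (hGdec : ∀ q, G q = m + χ q * A q) (hflat : ∀ ϑ : ℝ, χ (γ ϑ) = 1)
    (hcv : ContDiff ℝ 4 (fun ϑ : ℝ => χ (γ ϑ - v))) (hAv : ContDiff ℝ 4 (fun ϑ : ℝ => A (γ ϑ - v))) {k : ℕ} (hk : k ≤ 4) (θ : ℝ)
    {c a : ℕ → ℝ} (hc : ∀ i ≤ k, |iteratedDeriv i (fun ϑ : ℝ => χ (γ ϑ - v) - 1) θ| ≤ c i)
    (ha : ∀ j ≤ k, |iteratedDeriv j (fun ϑ : ℝ => A (γ ϑ - v)) θ| ≤ a j) {t : ℝ}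
    (ht : |iteratedDeriv k (fun ϑ : ℝ => A (γ ϑ - v)) θ - iteratedDeriv k (fun ϑ : ℝ => A (γ ϑ)) θ| ≤ t) :
    |iteratedDeriv k (fun ϑ : ℝ => G (γ ϑ - v)) θ - iteratedDeriv k (fun ϑ : ℝ => G (γ ϑ)) θ| ≤
      (∑ i ∈ Finset.range (k + 1), (k.choose i : ℝ) * c i * a (k - i)) + t := by
  have hk' : (k : WithTop ℕ∞) ≤ 4 := by exact_mod_cast hk
  rw [iteratedDeriv_displacedDiff_eq_structured hGdec hflat hcv hAv hk θ]
  refine (abs_add_le _ _).trans (add_le_add ?_ ht)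
  rw [abs_iteratedDeriv_eq_norm_iteratedFDeriv]
  refine (norm_iteratedFDeriv_mul_le (hcv.sub contDiff_const) hAv θ hk').trans (Finset.sum_le_sum fun i hi => ?_)
  have hik : i ≤ k := Nat.lt_succ_iff.mp (Finset.mem_range.mp hi)
  rw [← abs_iteratedDeriv_eq_norm_iteratedFDeriv, ← abs_iteratedDeriv_eq_norm_iteratedFDeriv]
  have h1 := hc i hik
  have h2 := ha (k - i) (Nat.sub_le k i)
  have hc0 : 0 ≤ c i := (abs_nonneg _).trans h1
  calc (k.choose i : ℝ) * |iteratedDeriv i (fun ϑ : ℝ => χ (γ ϑ - v) - 1) θ| * |iteratedDeriv (k - i) (fun ϑ : ℝ => A (γ ϑ - v)) θ|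
      ≤ (k.choose i : ℝ) * c i * a (k - i) := by
        refine mul_le_mul (mul_le_mul_of_nonneg_left h1 (by positivity)) h2 (abs_nonneg _) (by positivity)

end Pointwise

/-! ## §2 The integrated form: cutoff-defect moments -/

section Moments

variable (d : ℕ) {F : (Fin 2 → ℝ) → ℝ} {χ A : EuclideanSpace ℝ (Fin 2) → ℝ} {m : ℝ} {γ : ℝ → EuclideanSpace ℝ (Fin 2)}

/-- **THE (C1) DOOR v2 IN CUTOFF-DEFECT-MOMENT FORM.**  `F∘ofLp = m + χ·A`, `χ∘γ ≡ 1`, `χ ∈ C⁴`; on the sub-square `|s|,|t| ≤ δ₂` the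
displaced angular factor `A∘(γ − v_w)` is `C⁴` in `ϑ` with jets `≤ a j` at `θ`, the transport is `≤ Tr(|s|+|t|) + Tc`, and the cutoff-defect jets
`|∂ⁱ[χ∘(γ − v_w) − 1](θ)|` are dominated by continuous `cdef i ≥ 0` with MOMENTS `∫ J̃J̃·cdef i ≤ N i`; beyond the sub-square the displaced
difference is `≤ S`.  Then, for any first-moment bound `m₁`,
`|∂ᵏ[(F − 𝒥_dF)∘ofLp∘γ](θ)| ≤ Σ_{i≤k} C(k,i)·N i·a (k−i) + Tr·m₁ + Tc + S·π³/((d+1)δ₂)³` (`k ≤ 4`). -/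
theorem abs_iteratedDeriv_jhigh1_comp_curve_le_defectMoments (hF : Continuous F)
    (hG : ContDiff ℝ 4 (fun q : EuclideanSpace ℝ (Fin 2) => F (WithLp.ofLp q))) (hγ : ContDiff ℝ 4 γ) {k : ℕ} (hk : k ≤ 4) (θ : ℝ)
    (hGdec : ∀ q, F (WithLp.ofLp q) = m + χ q * A q) (hflat : ∀ ϑ : ℝ, χ (γ ϑ) = 1) (hχ : ContDiff ℝ 4 χ)
    {δ₂ : ℝ} (hδ₂ : 0 < δ₂) (hδ₂π : δ₂ ≤ π)
    (hAv : ∀ w : ℝ × ℝ, |w.1| ≤ δ₂ → |w.2| ≤ δ₂ → ContDiff ℝ 4 (fun ϑ : ℝ => A (γ ϑ - jshift w)))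
    {cdef : ℕ → ℝ × ℝ → ℝ} (hcdef_cont : ∀ i ≤ k, Continuous (cdef i)) (hcdef_nn : ∀ i ≤ k, ∀ w, 0 ≤ cdef i w)
    (hcdef : ∀ w : ℝ × ℝ, |w.1| ≤ δ₂ → |w.2| ≤ δ₂ → ∀ i ≤ k,
      |iteratedDeriv i (fun ϑ : ℝ => χ (γ ϑ - jshift w) - 1) θ| ≤ cdef i w)
    {N : ℕ → ℝ} (hN : ∀ i ≤ k, ∫ w, jweight d w * cdef i w ∂jmeas ≤ N i)
    {a : ℕ → ℝ} (ha_nn : ∀ j ≤ k, 0 ≤ a j)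
    (ha : ∀ w : ℝ × ℝ, |w.1| ≤ δ₂ → |w.2| ≤ δ₂ → ∀ j ≤ k, |iteratedDeriv j (fun ϑ : ℝ => A (γ ϑ - jshift w)) θ| ≤ a j)
    {Tr Tc : ℝ} (hTr : 0 ≤ Tr) (hTc : 0 ≤ Tc)
    (ht : ∀ w : ℝ × ℝ, |w.1| ≤ δ₂ → |w.2| ≤ δ₂ →
      |iteratedDeriv k (fun ϑ : ℝ => A (γ ϑ - jshift w)) θ - iteratedDeriv k (fun ϑ : ℝ => A (γ ϑ)) θ| ≤ Tr * (|w.1| + |w.2|) + Tc)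
    {S : ℝ} (hS : 0 ≤ S)
    (hfar : ∀ w ∈ Set.Icc (-π) π ×ˢ Set.Icc (-π) π, (δ₂ < |w.1| ∨ δ₂ < |w.2|) →
      |iteratedDeriv k (fun ϑ : ℝ => F (WithLp.ofLp (γ ϑ - jshift w))) θ - iteratedDeriv k (fun ϑ : ℝ => F (WithLp.ofLp (γ ϑ))) θ| ≤ S)
    {m₁ : ℝ} (hm₁ : ∫ w, jweight d w * (|w.1| + |w.2|) ∂jmeas ≤ m₁) :
    |iteratedDeriv k ((fun q : EuclideanSpace ℝ (Fin 2) => jhigh1 d F (WithLp.ofLp q)) ∘ γ) θ| ≤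
      (∑ i ∈ Finset.range (k + 1), (k.choose i : ℝ) * N i * a (k - i)) + Tr * m₁ + Tc + S * (π ^ 3 / ((d + 1) * δ₂) ^ 3) := by
  -- the structured part of the majorant
  set P : ℝ × ℝ → ℝ := fun w => ∑ i ∈ Finset.range (k + 1), (k.choose i : ℝ) * cdef i w * a (k - i) with hP
  have hPnn : ∀ w, 0 ≤ P w := fun w => Finset.sum_nonneg fun i hi => by
    have hik : i ≤ k := Nat.lt_succ_iff.mp (Finset.mem_range.mp hi)
    exact mul_nonneg (mul_nonneg (by positivity) (hcdef_nn i hik w)) (ha_nn _ (Nat.sub_le k i))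
  have hPc : Continuous P := continuous_finsetSum _ fun i hi => by
    have hik : i ≤ k := Nat.lt_succ_iff.mp (Finset.mem_range.mp hi)
    exact (continuous_const.mul (hcdef_cont i hik)).mul continuous_const
  -- the pointwise bound on the sub-square
  have hnear : ∀ w : ℝ × ℝ, |w.1| ≤ δ₂ → |w.2| ≤ δ₂ →
      |iteratedDeriv k (fun ϑ : ℝ => F (WithLp.ofLp (γ ϑ - jshift w))) θ - iteratedDeriv k (fun ϑ : ℝ => F (WithLp.ofLp (γ ϑ))) θ| ≤
        P w + (Tr * (|w.1| + |w.2|) + Tc) := by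
    intro w h1 h2
    have hcv : ContDiff ℝ 4 (fun ϑ : ℝ => χ (γ ϑ - jshift w)) := hχ.comp (hγ.sub contDiff_const)
    exact abs_iteratedDeriv_displacedDiff_le_structured (G := fun q : EuclideanSpace ℝ (Fin 2) => F (WithLp.ofLp q)) hGdec hflat hcv
      (hAv w h1 h2) hk θ (hcdef w h1 h2) (ha w h1 h2) (ht w h1 h2)
  -- apply part 1's split with A := Tr, C := … no: the structured part is w-dependent, so use the majorant form directly
  set maj : ℝ × ℝ → ℝ := fun w => P w + (Tr * (|w.1| + |w.2|) + Tc) +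
    S * (Set.indicator {s : ℝ | δ₂ < |s|} (1 : ℝ → ℝ) w.1 + Set.indicator {s : ℝ | δ₂ < |s|} (1 : ℝ → ℝ) w.2) with hmaj
  have iP : Integrable (fun w : ℝ × ℝ => jweight d w * P w) jmeas := integrable_jmeas_of_continuous ((continuous_jweight d).mul hPc)
  have iT : Integrable (fun w : ℝ × ℝ => jweight d w * (Tr * (|w.1| + |w.2|) + Tc)) jmeas :=
    integrable_jmeas_of_continuous ((continuous_jweight d).mul
      ((continuous_const.mul (continuous_fst.abs.add continuous_snd.abs)).add continuous_const))
  have iS : Integrable (fun w : ℝ × ℝ => S * (jweight d w *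
      (Set.indicator {s : ℝ | δ₂ < |s|} (1 : ℝ → ℝ) w.1 + Set.indicator {s : ℝ | δ₂ < |s|} (1 : ℝ → ℝ) w.2))) jmeas := by
    have := ((integrable_jweight_mul_jfar_fst d δ₂).add (integrable_jweight_mul_jfar_snd d δ₂)).const_mul S
    refine this.congr (Eventually.of_forall fun w => ?_)
    show S * (jweight d w * Set.indicator {s : ℝ | δ₂ < |s|} (1 : ℝ → ℝ) w.1 + jweight d w * Set.indicator {s : ℝ | δ₂ < |s|} (1 : ℝ → ℝ) w.2) = _
    ring
  have e : (fun w => jweight d w * maj w) = fun w => (jweight d w * P w + jweight d w * (Tr * (|w.1| + |w.2|) + Tc)) +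
      S * (jweight d w * (Set.indicator {s : ℝ | δ₂ < |s|} (1 : ℝ → ℝ) w.1 + Set.indicator {s : ℝ | δ₂ < |s|} (1 : ℝ → ℝ) w.2)) := by
    funext w; simp only [hmaj]; ring
  have iPT : Integrable (fun w : ℝ × ℝ => jweight d w * P w + jweight d w * (Tr * (|w.1| + |w.2|) + Tc)) jmeas := iP.add iT
  have hint : Integrable (fun w => jweight d w * maj w) jmeas := by rw [e]; exact iPT.add iS
  -- majorant property on the square
  have hM : ∀ w ∈ Set.Icc (-π) π ×ˢ Set.Icc (-π) π,
      |iteratedDeriv k (fun ϑ : ℝ => F (WithLp.ofLp (γ ϑ - jshift w))) θ - iteratedDeriv k (fun ϑ : ℝ => F (WithLp.ofLp (γ ϑ))) θ| ≤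
        maj w := by
    intro w hw
    have hind0 : 0 ≤ Set.indicator {s : ℝ | δ₂ < |s|} (1 : ℝ → ℝ) w.1 + Set.indicator {s : ℝ | δ₂ < |s|} (1 : ℝ → ℝ) w.2 :=
      add_nonneg (jfar_nonneg _ _) (jfar_nonneg _ _)
    have hPT0 : 0 ≤ P w + (Tr * (|w.1| + |w.2|) + Tc) :=
      add_nonneg (hPnn w) (add_nonneg (mul_nonneg hTr (add_nonneg (abs_nonneg _) (abs_nonneg _))) hTc)
    by_cases hnw : |w.1| ≤ δ₂ ∧ |w.2| ≤ δ₂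
    · calc _ ≤ P w + (Tr * (|w.1| + |w.2|) + Tc) := hnear w hnw.1 hnw.2
        _ ≤ maj w := le_add_of_nonneg_right (mul_nonneg hS hind0)
    · have hor : δ₂ < |w.1| ∨ δ₂ < |w.2| := by
        rcases not_and_or.mp hnw with h1 | h2
        · exact Or.inl (not_le.mp h1)
        · exact Or.inr (not_le.mp h2)
      have hind : (1 : ℝ) ≤ Set.indicator {s : ℝ | δ₂ < |s|} (1 : ℝ → ℝ) w.1 + Set.indicator {s : ℝ | δ₂ < |s|} (1 : ℝ → ℝ) w.2 := by
        rcases hor with h1 | h2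
        · rw [jfar_eq_one h1]; linarith [jfar_nonneg δ₂ w.2]
        · rw [jfar_eq_one h2]; linarith [jfar_nonneg δ₂ w.1]
      calc _ ≤ S := hfar w hw hor
        _ ≤ S * (Set.indicator {s : ℝ | δ₂ < |s|} (1 : ℝ → ℝ) w.1 + Set.indicator {s : ℝ | δ₂ < |s|} (1 : ℝ → ℝ) w.2) :=
            le_mul_of_one_le_right hS hind
        _ ≤ maj w := by simp only [hmaj]; linarith
  refine (abs_iteratedDeriv_jhigh1_comp_curve_le_integral d hF hG hγ hk θ hint hM).trans ?_
  -- evaluate the integral of the majorant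
  rw [e, integral_add iPT iS, integral_add iP iT, integral_const_mul]
  -- structured part: `∫ J̃J̃·P = Σ C(k,i)·a(k−i)·∫ J̃J̃·cdef i ≤ Σ C(k,i)·N i·a(k−i)`
  have hPint : ∫ w, jweight d w * P w ∂jmeas ≤ ∑ i ∈ Finset.range (k + 1), (k.choose i : ℝ) * N i * a (k - i) := by
    have eP : (fun w => jweight d w * P w) = fun w => ∑ i ∈ Finset.range (k + 1), ((k.choose i : ℝ) * a (k - i)) * (jweight d w * cdef i w) := by
      funext w; simp only [hP, Finset.mul_sum]; refine Finset.sum_congr rfl fun i _ => ?_; ring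
    have ii : ∀ i ∈ Finset.range (k + 1), Integrable (fun w => ((k.choose i : ℝ) * a (k - i)) * (jweight d w * cdef i w)) jmeas :=
      fun i hi => (integrable_jmeas_of_continuous ((continuous_jweight d).mul
        (hcdef_cont i (Nat.lt_succ_iff.mp (Finset.mem_range.mp hi))))).const_mul _
    rw [eP, integral_finsetSum _ ii]
    refine Finset.sum_le_sum fun i hi => ?_
    have hik : i ≤ k := Nat.lt_succ_iff.mp (Finset.mem_range.mp hi)
    rw [integral_const_mul]
    calc (k.choose i : ℝ) * a (k - i) * ∫ w, jweight d w * cdef i w ∂jmeas ≤ (k.choose i : ℝ) * a (k - i) * N i :=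
          mul_le_mul_of_nonneg_left (hN i hik) (mul_nonneg (by positivity) (ha_nn _ (Nat.sub_le k i)))
      _ = (k.choose i : ℝ) * N i * a (k - i) := by ring
  -- transport part
  have hTint : ∫ w, jweight d w * (Tr * (|w.1| + |w.2|) + Tc) ∂jmeas ≤ Tr * m₁ + Tc := by
    have eT : (fun w : ℝ × ℝ => jweight d w * (Tr * (|w.1| + |w.2|) + Tc)) =
        fun w => Tr * (jweight d w * (|w.1| + |w.2|)) + jweight d w * Tc := by funext w; ring
    have i1 : Integrable (fun w : ℝ × ℝ => Tr * (jweight d w * (|w.1| + |w.2|))) jmeas :=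
      (integrable_jmeas_of_continuous ((continuous_jweight d).mul (continuous_fst.abs.add continuous_snd.abs))).const_mul _
    have i2 : Integrable (fun w : ℝ × ℝ => jweight d w * Tc) jmeas := (integrable_jmeas_of_continuous (continuous_jweight d)).mul_const _
    rw [eT, integral_add i1 i2, integral_const_mul, integral_mul_const, integral_jweight, one_mul]
    exact add_le_add (mul_le_mul_of_nonneg_left hm₁ hTr) le_rfl
  have hSint := integral_jweight_mul_jfar_le d hδ₂ hδ₂π
  nlinarith [mul_le_mul_of_nonneg_left hSint hS]

end Moments

/-! ## §3 The mixed-moment form (every factor inside the smoothing integral) -/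

section Mixed

variable (d : ℕ) {F : (Fin 2 → ℝ) → ℝ} {χ A : EuclideanSpace ℝ (Fin 2) → ℝ} {m : ℝ} {γ : ℝ → EuclideanSpace ℝ (Fin 2)}

/-- **THE (C1) DOOR v2 IN MIXED-MOMENT FORM** (the form the low-scale certificate uses: evidence `C1-CUTOFF-DEFECT-MOMENTS.md` §3–§4 on
20437 — sup-sizes of the displaced angular factor are unusable far from the curve, so BOTH factors stay inside the integral).  `F∘ofLp = m + χ·A`,
`χ∘γ ≡ 1`, `χ ∈ C⁴`; on the sub-square `|s|,|t| ≤ δ₂`: `A∘(γ − v_w)` is `C⁴` in `ϑ`, the cutoff-defect jets `|∂ⁱ[χ∘(γ−v_w) − 1](θ)| ≤ cdef i w`, the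
displaced angular jets `|∂ʲ[A∘(γ−v_w)](θ)| ≤ adef j w` and the transport `|∂ᵏ[A∘(γ−v_w)](θ) − ∂ᵏ[A∘γ](θ)| ≤ tdef w` (continuous, nonnegative
majorants) with MIXED MOMENTS `∫J̃J̃·cdef i·adef (k−i) ≤ Mx i` and `∫J̃J̃·tdef ≤ Tm`; beyond the sub-square the displaced difference is `≤ S`.  Then
`|∂ᵏ[(F − 𝒥_dF)∘ofLp∘γ](θ)| ≤ Σ_{i≤k} C(k,i)·Mx i + Tm + S·π³/((d+1)δ₂)³` (`k ≤ 4`; take `δ₂ = π` to have no far term). -/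
theorem abs_iteratedDeriv_jhigh1_comp_curve_le_mixedMoments (hF : Continuous F)
    (hG : ContDiff ℝ 4 (fun q : EuclideanSpace ℝ (Fin 2) => F (WithLp.ofLp q))) (hγ : ContDiff ℝ 4 γ) {k : ℕ} (hk : k ≤ 4) (θ : ℝ)
    (hGdec : ∀ q, F (WithLp.ofLp q) = m + χ q * A q) (hflat : ∀ ϑ : ℝ, χ (γ ϑ) = 1) (hχ : ContDiff ℝ 4 χ)
    {δ₂ : ℝ} (hδ₂ : 0 < δ₂) (hδ₂π : δ₂ ≤ π)
    (hAv : ∀ w : ℝ × ℝ, |w.1| ≤ δ₂ → |w.2| ≤ δ₂ → ContDiff ℝ 4 (fun ϑ : ℝ => A (γ ϑ - jshift w)))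
    {cdef adef : ℕ → ℝ × ℝ → ℝ} (hcdef_cont : ∀ i ≤ k, Continuous (cdef i)) (hcdef_nn : ∀ i ≤ k, ∀ w, 0 ≤ cdef i w)
    (hadef_cont : ∀ j ≤ k, Continuous (adef j)) (hadef_nn : ∀ j ≤ k, ∀ w, 0 ≤ adef j w)
    (hcdef : ∀ w : ℝ × ℝ, |w.1| ≤ δ₂ → |w.2| ≤ δ₂ → ∀ i ≤ k,
      |iteratedDeriv i (fun ϑ : ℝ => χ (γ ϑ - jshift w) - 1) θ| ≤ cdef i w)
    (hadef : ∀ w : ℝ × ℝ, |w.1| ≤ δ₂ → |w.2| ≤ δ₂ → ∀ j ≤ k, |iteratedDeriv j (fun ϑ : ℝ => A (γ ϑ - jshift w)) θ| ≤ adef j w)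
    {Mx : ℕ → ℝ} (hMx : ∀ i ≤ k, ∫ w, jweight d w * (cdef i w * adef (k - i) w) ∂jmeas ≤ Mx i)
    {tdef : ℝ × ℝ → ℝ} (htdef_cont : Continuous tdef) (htdef_nn : ∀ w, 0 ≤ tdef w)
    (ht : ∀ w : ℝ × ℝ, |w.1| ≤ δ₂ → |w.2| ≤ δ₂ →
      |iteratedDeriv k (fun ϑ : ℝ => A (γ ϑ - jshift w)) θ - iteratedDeriv k (fun ϑ : ℝ => A (γ ϑ)) θ| ≤ tdef w)
    {Tm : ℝ} (hTm : ∫ w, jweight d w * tdef w ∂jmeas ≤ Tm)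
    {S : ℝ} (hS : 0 ≤ S)
    (hfar : ∀ w ∈ Set.Icc (-π) π ×ˢ Set.Icc (-π) π, (δ₂ < |w.1| ∨ δ₂ < |w.2|) →
      |iteratedDeriv k (fun ϑ : ℝ => F (WithLp.ofLp (γ ϑ - jshift w))) θ - iteratedDeriv k (fun ϑ : ℝ => F (WithLp.ofLp (γ ϑ))) θ| ≤ S) :
    |iteratedDeriv k ((fun q : EuclideanSpace ℝ (Fin 2) => jhigh1 d F (WithLp.ofLp q)) ∘ γ) θ| ≤
      (∑ i ∈ Finset.range (k + 1), (k.choose i : ℝ) * Mx i) + Tm + S * (π ^ 3 / ((d + 1) * δ₂) ^ 3) := by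
  -- the structured part of the majorant (w-dependent in both factors) plus the transport majorant
  set P : ℝ × ℝ → ℝ := fun w => (∑ i ∈ Finset.range (k + 1), (k.choose i : ℝ) * cdef i w * adef (k - i) w) + tdef w with hP
  have hPnn : ∀ w, 0 ≤ P w := fun w => add_nonneg (Finset.sum_nonneg fun i hi => by
    have hik : i ≤ k := Nat.lt_succ_iff.mp (Finset.mem_range.mp hi)
    exact mul_nonneg (mul_nonneg (by positivity) (hcdef_nn i hik w)) (hadef_nn _ (Nat.sub_le k i) w)) (htdef_nn w)
  have hPc : Continuous P := (continuous_finsetSum _ fun i hi => by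
    have hik : i ≤ k := Nat.lt_succ_iff.mp (Finset.mem_range.mp hi)
    exact (continuous_const.mul (hcdef_cont i hik)).mul (hadef_cont _ (Nat.sub_le k i))).add htdef_cont
  have hnear : ∀ w : ℝ × ℝ, |w.1| ≤ δ₂ → |w.2| ≤ δ₂ →
      |iteratedDeriv k (fun ϑ : ℝ => F (WithLp.ofLp (γ ϑ - jshift w))) θ - iteratedDeriv k (fun ϑ : ℝ => F (WithLp.ofLp (γ ϑ))) θ| ≤ P w := by
    intro w h1 h2
    have hcv : ContDiff ℝ 4 (fun ϑ : ℝ => χ (γ ϑ - jshift w)) := hχ.comp (hγ.sub contDiff_const)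
    exact abs_iteratedDeriv_displacedDiff_le_structured (G := fun q : EuclideanSpace ℝ (Fin 2) => F (WithLp.ofLp q)) hGdec hflat hcv
      (hAv w h1 h2) hk θ (c := fun i => cdef i w) (a := fun j => adef j w) (hcdef w h1 h2) (hadef w h1 h2) (ht w h1 h2)
  set maj : ℝ × ℝ → ℝ := fun w => P w +
    S * (Set.indicator {s : ℝ | δ₂ < |s|} (1 : ℝ → ℝ) w.1 + Set.indicator {s : ℝ | δ₂ < |s|} (1 : ℝ → ℝ) w.2) with hmaj
  have iP : Integrable (fun w : ℝ × ℝ => jweight d w * P w) jmeas := integrable_jmeas_of_continuous ((continuous_jweight d).mul hPc)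
  have iS : Integrable (fun w : ℝ × ℝ => S * (jweight d w *
      (Set.indicator {s : ℝ | δ₂ < |s|} (1 : ℝ → ℝ) w.1 + Set.indicator {s : ℝ | δ₂ < |s|} (1 : ℝ → ℝ) w.2))) jmeas := by
    have := ((integrable_jweight_mul_jfar_fst d δ₂).add (integrable_jweight_mul_jfar_snd d δ₂)).const_mul S
    refine this.congr (Eventually.of_forall fun w => ?_)
    show S * (jweight d w * Set.indicator {s : ℝ | δ₂ < |s|} (1 : ℝ → ℝ) w.1 + jweight d w * Set.indicator {s : ℝ | δ₂ < |s|} (1 : ℝ → ℝ) w.2) = _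
    ring
  have e : (fun w => jweight d w * maj w) = fun w => jweight d w * P w +
      S * (jweight d w * (Set.indicator {s : ℝ | δ₂ < |s|} (1 : ℝ → ℝ) w.1 + Set.indicator {s : ℝ | δ₂ < |s|} (1 : ℝ → ℝ) w.2)) := by
    funext w; simp only [hmaj]; ring
  have hint : Integrable (fun w => jweight d w * maj w) jmeas := by rw [e]; exact iP.add iS
  have hM : ∀ w ∈ Set.Icc (-π) π ×ˢ Set.Icc (-π) π,
      |iteratedDeriv k (fun ϑ : ℝ => F (WithLp.ofLp (γ ϑ - jshift w))) θ - iteratedDeriv k (fun ϑ : ℝ => F (WithLp.ofLp (γ ϑ))) θ| ≤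
        maj w := by
    intro w hw
    have hind0 : 0 ≤ Set.indicator {s : ℝ | δ₂ < |s|} (1 : ℝ → ℝ) w.1 + Set.indicator {s : ℝ | δ₂ < |s|} (1 : ℝ → ℝ) w.2 :=
      add_nonneg (jfar_nonneg _ _) (jfar_nonneg _ _)
    by_cases hnw : |w.1| ≤ δ₂ ∧ |w.2| ≤ δ₂
    · calc _ ≤ P w := hnear w hnw.1 hnw.2
        _ ≤ maj w := le_add_of_nonneg_right (mul_nonneg hS hind0)
    · have hor : δ₂ < |w.1| ∨ δ₂ < |w.2| := by
        rcases not_and_or.mp hnw with h1 | h2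
        · exact Or.inl (not_le.mp h1)
        · exact Or.inr (not_le.mp h2)
      have hind : (1 : ℝ) ≤ Set.indicator {s : ℝ | δ₂ < |s|} (1 : ℝ → ℝ) w.1 + Set.indicator {s : ℝ | δ₂ < |s|} (1 : ℝ → ℝ) w.2 := by
        rcases hor with h1 | h2
        · rw [jfar_eq_one h1]; linarith [jfar_nonneg δ₂ w.2]
        · rw [jfar_eq_one h2]; linarith [jfar_nonneg δ₂ w.1]
      calc _ ≤ S := hfar w hw hor
        _ ≤ S * (Set.indicator {s : ℝ | δ₂ < |s|} (1 : ℝ → ℝ) w.1 + Set.indicator {s : ℝ | δ₂ < |s|} (1 : ℝ → ℝ) w.2) :=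
            le_mul_of_one_le_right hS hind
        _ ≤ maj w := by simp only [hmaj]; linarith [hPnn w]
  refine (abs_iteratedDeriv_jhigh1_comp_curve_le_integral d hF hG hγ hk θ hint hM).trans ?_
  rw [e, integral_add iP iS, integral_const_mul]
  have hPint : ∫ w, jweight d w * P w ∂jmeas ≤ (∑ i ∈ Finset.range (k + 1), (k.choose i : ℝ) * Mx i) + Tm := by
    have eP : (fun w => jweight d w * P w) =
        fun w => (∑ i ∈ Finset.range (k + 1), (k.choose i : ℝ) * (jweight d w * (cdef i w * adef (k - i) w))) + jweight d w * tdef w := by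
      funext w; simp only [hP, mul_add, Finset.mul_sum]; congr 1; refine Finset.sum_congr rfl fun i _ => ?_; ring
    have ii : ∀ i ∈ Finset.range (k + 1), Integrable (fun w => (k.choose i : ℝ) * (jweight d w * (cdef i w * adef (k - i) w))) jmeas := by
      intro i hi
      have hik : i ≤ k := Nat.lt_succ_iff.mp (Finset.mem_range.mp hi)
      exact (integrable_jmeas_of_continuous ((continuous_jweight d).mul ((hcdef_cont i hik).mul (hadef_cont _ (Nat.sub_le k i))))).const_mul _
    have iS1 : Integrable (fun w => ∑ i ∈ Finset.range (k + 1), (k.choose i : ℝ) * (jweight d w * (cdef i w * adef (k - i) w))) jmeas :=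
      integrable_finsetSum _ ii
    have iT : Integrable (fun w => jweight d w * tdef w) jmeas := integrable_jmeas_of_continuous ((continuous_jweight d).mul htdef_cont)
    rw [eP, integral_add iS1 iT, integral_finsetSum _ ii]
    refine add_le_add (Finset.sum_le_sum fun i hi => ?_) hTm
    have hik : i ≤ k := Nat.lt_succ_iff.mp (Finset.mem_range.mp hi)
    rw [integral_const_mul]
    exact mul_le_mul_of_nonneg_left (hMx i hik) (by positivity)
  have hSint := integral_jweight_mul_jfar_le d hδ₂ hδ₂π
  nlinarith [mul_le_mul_of_nonneg_left hSint hS]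

end Mixed

end Summit.HubbardSuperconductivity.HubbardSuperconductivity.Theorems.KLRegimeSplit

end
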